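import Mathlib
import HarnessLib
import Summits.ValiantsHypothesis.ValiantsHypothesis.Theorems.MonotoneRestorationOrbitRestorationQPPerNotNarrow
import Summits.ValiantsHypothesis.ValiantsHypothesis.Theorems.MonotoneRestorationOrbitRestorationQPSharpResiduePolylogDegree

/-!
# A_∞ in SPAN currency: the rung follows from a treewidth bound on the hom-expansions of depth-three-easy families
# (crux `OrbitRestorationQP`, stmt-ValiantsHypothesis-18293 — line `depth-three-rung`, registered stub `stub_sigmaPiSigmaValue` = A_∞)

Namespace `Summit.ValiantsHypothesis.ValiantsHypothesis.Theorems.SmlAffineRestoration`.  Definition-free.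

K1's span currency (`OrbitRestorationQPHomPolyClose.qpOrbit_of_mem_narrowSpan`: membership of every level in the `ℂ`-span of the
homomorphism polynomials of bipartite patterns of treewidth `≤ (log₂ n + c)^c` gives square-symmetric circuits of orbit size
`≤ 2^((log₂ n + c + 3)^(c+3))`) turns the rung A_∞ into a DEPTH-THREE LOWER-BOUND statement: it suffices that polynomial-size `ΣΠΣ`
circuits cannot produce matrix-symmetric polynomials whose (unique, `HomExpansionUnique`) hom-expansion charges patterns of
super-polylogarithmic treewidth.  This file records the reduction in the kernel, per level and inside the sharpened residue:

* `qpOrbitRestorable_of_mem_narrowSpan_level` — per-level wrapper: `p ∈ span{hom_F : tw F ≤ (log₂ n + c)^c}` at level `n`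
  `→ QPOrbitRestorable (c + 3) n p`;
* `sigmaPiSigmaValue_of_twLB` — **(TW-LB ⇒ A_∞)**: if for every `c` there is `c'` such that every matrix-symmetric
  `p ∈ PDClass (fun _ => 1) n c` lies in the treewidth-`(log₂ n + c')^{c'}` span, then the registered stub holds (signature verbatim);
* `sigmaPiSigmaValue_of_sharpResidue_twLB` — the same with TW-LB required only on the residue of `sigmaPiSigmaValue_of_sharpResidue₉`
  (eleven exclusions).

Honest label: a reformulation (the target of a Limaye–Srinivasan–Tavenas-type lower-bound programme, memo CLOSURE-RESIDUE-g9 §6);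
no stub closed; VP ≠ VNP untouched. [folklore] [cite: DwivediPagoSeppelt2026, §8; DawarWilsenach2025, §3.3]
-/

noncomputable section

open scoped Classical

-- `Summit.ValiantsHypothesis.ValiantsHypothesis.…` is the tree's single-conjunct layout (Sub = Summit).
set_option linter.dupNamespace false

namespace Summit.ValiantsHypothesis.ValiantsHypothesis.Theorems.SmlAffineRestoration

open MvPolynomial Finset Equiv Literature.Computability.AlgebraicComplexity OrbitRestorationQPDepthThreeRung DerivativeTower
  OrbitRestorationQPHomPolyClose

/-- **Per-level span-to-orbit wrapper.**  If `p` at level `n` lies in the span of the homomorphism polynomials of bipartite patterns of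
treewidth `≤ (log₂ n + c)^c`, then `QPOrbitRestorable (c + 3) n p`. [folklore] -/
theorem qpOrbitRestorable_of_mem_narrowSpan_level (c n : ℕ) (p : MvPolynomial (Fin n × Fin n) ℂ)
    (hp : p ∈ Submodule.span ℂ
        {q : MvPolynomial (Fin n × Fin n) ℂ | ∃ (a b : ℕ) (E : Multiset (Fin a × Fin b)),
          Literature.Combinatorics.SimpleGraph.treewidth
              (SimpleGraph.fromRel fun u v : Fin a ⊕ Fin b =>
                ∃ e ∈ E, u = Sum.inl e.1 ∧ v = Sum.inr e.2) ≤ (Nat.log 2 n + c) ^ c ∧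
            q = homPoly E n ℂ}) :
    QPOrbitRestorable (c + 3) n p := by
  -- the one-level family `m ↦ (p at m = n, 0 elsewhere)`
  let f : (m : ℕ) → MvPolynomial (Fin m × Fin m) ℂ := Function.update (fun m => 0) n p
  have hf : ∀ m : ℕ, f m ∈ Submodule.span ℂ
      {q : MvPolynomial (Fin m × Fin m) ℂ | ∃ (a b : ℕ) (E : Multiset (Fin a × Fin b)),
        Literature.Combinatorics.SimpleGraph.treewidth
            (SimpleGraph.fromRel fun u v : Fin a ⊕ Fin b =>
              ∃ e ∈ E, u = Sum.inl e.1 ∧ v = Sum.inr e.2) ≤ (Nat.log 2 m + c) ^ c ∧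
          q = homPoly E m ℂ} := by
    intro m
    by_cases hm : m = n
    · subst hm
      simp only [f, Function.update_self]
      exact hp
    · simp only [f, Function.update_of_ne hm]
      exact Submodule.zero_mem _
  obtain ⟨G, inst, C, hC, hev, horb⟩ := qpOrbit_of_mem_narrowSpan f c hf n
  refine ⟨G, inst, C, hC, ?_, horb⟩
  rw [hev]
  simp only [f, Function.update_self]

/-- **TW-LB ⇒ A_∞.**  If for every `c` there is `c'` such that every matrix-symmetric `p ∈ PDClass (fun _ => 1) n c` (any `n`) lies in
the span of the homomorphism polynomials of bipartite patterns of treewidth `≤ (log₂ n + c')^{c'}`, then the registered stub A_∞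
holds (conclusion = its signature verbatim). [folklore] -/
theorem sigmaPiSigmaValue_of_twLB
    (hTW : ∀ c : ℕ, ∃ c' : ℕ, ∀ (n : ℕ) (p : MvPolynomial (Fin n × Fin n) ℂ),
      (∀ σ τ : Perm (Fin n), rename (fun q : Fin n × Fin n => (σ q.1, τ q.2)) p = p) →
      PDClass (fun _ => 1) n c p →
      p ∈ Submodule.span ℂ
        {q : MvPolynomial (Fin n × Fin n) ℂ | ∃ (a b : ℕ) (E : Multiset (Fin a × Fin b)),
          Literature.Combinatorics.SimpleGraph.treewidth
              (SimpleGraph.fromRel fun u v : Fin a ⊕ Fin b =>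
                ∃ e ∈ E, u = Sum.inl e.1 ∧ v = Sum.inr e.2) ≤ (Nat.log 2 n + c') ^ c' ∧
            q = homPoly E n ℂ}) :
    ∀ f : (n : ℕ) → MvPolynomial (Fin n × Fin n) ℂ, IsMatrixSymmetric f →
      (∃ c : ℕ, ∀ n : ℕ, PDClass (fun _ => 1) n c (f n)) →
      ∃ c : ℕ, ∀ n : ℕ, QPOrbitRestorable c n (f n) := by
  intro f hsym ⟨c, hPD⟩
  obtain ⟨c', hc'⟩ := hTW c
  exact ⟨c' + 3, fun n => qpOrbitRestorable_of_mem_narrowSpan_level c' n (f n) (hc' n (f n) (hsym n) (hPD n))⟩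

/-- **TW-LB ON THE RESIDUE ⇒ A_∞.**  It suffices that the residue elements of `sigmaPiSigmaValue_of_sharpResidue₉` (matrix-symmetric
`p ∈ PDClass (fun _ => 1) n c` with the eleven exclusions) lie in the treewidth-`(log₂ n + c')^{c'}` span. [folklore] -/
theorem sigmaPiSigmaValue_of_sharpResidue_twLB
    (hTW : ∀ c : ℕ, ∃ c' : ℕ, ∀ (n : ℕ) (p : MvPolynomial (Fin n × Fin n) ℂ),
      (∀ σ τ : Perm (Fin n), rename (fun q : Fin n × Fin n => (σ q.1, τ q.2)) p = p) →
      PDClass (fun _ => 1) n c p → ¬ GroupableUpTo 0 n c p →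
      (∃ a a' b b' : Fin n, pderiv (a, b) p - pderiv (a', b) p - pderiv (a, b') p + pderiv (a', b') p ≠ 0) →
      (∃ (i : Fin n) (τ : Perm (Fin n)),
        rename (fun q : Fin n × Fin n => if q.1 = i then (q.1, τ q.2) else q) p ≠ p) →
      (∃ (j : Fin n) (τ : Perm (Fin n)),
        rename (fun q : Fin n × Fin n => if q.2 = j then (τ q.1, q.2) else q) p ≠ p) →
      (¬ ∃ (s : ℕ) (β : Fin s → Fin n → ℂ) (α : Fin s → Fin n → Fin n → ℂ), s ≤ n ^ c + c ∧
        p = ∑ t : Fin s, ∏ b : Fin n, (C (β t b) + ∑ a : Fin n, C (α t b a) * X (a, b))) →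
      (¬ ∃ (s : ℕ) (β : Fin s → Fin n → ℂ) (α : Fin s → Fin n → Fin n → ℂ), s ≤ n ^ c + c ∧
        p = ∑ t : Fin s, ∏ a : Fin n, (C (β t a) + ∑ b : Fin n, C (α t a b) * X (a, b))) →
      (∃ e m : ℕ, FiniteDimensional ℂ (derivChain (homogeneousComponent e p) m) →
        n ^ c + c < Module.finrank ℂ (derivChain (homogeneousComponent e p) m)) →
      (¬ ∃ (α β γ δ ε : ℂ) (q : MvPolynomial (Fin n × Fin n) ℂ),
        (∀ σ τ : Perm (Fin n), rename (fun x : Fin n × Fin n => (σ x.1, τ x.2)) q = q) ∧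
        (∃ (s : ℕ) (β' : Fin s → Fin n → ℂ) (α' : Fin s → Fin n → Fin n → ℂ), s ≤ n ^ c + c ∧
          q = ∑ t : Fin s, ∏ b : Fin n, (C (β' t b) + ∑ a : Fin n, C (α' t b a) * X (a, b))) ∧
        p = aeval (fun x : Fin n × Fin n => C α * X x + C β * ∑ b : Fin n, X (x.1, b) + C γ * ∑ a : Fin n, X (a, x.2) +
          C δ * ∑ a : Fin n, ∑ b : Fin n, X (a, b) + C ε : Fin n × Fin n → MvPolynomial (Fin n × Fin n) ℂ) q) →
      (¬ ∃ (α β γ δ ε : ℂ) (q : MvPolynomial (Fin n × Fin n) ℂ),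
        (∀ σ τ : Perm (Fin n), rename (fun x : Fin n × Fin n => (σ x.1, τ x.2)) q = q) ∧
        (∃ (s : ℕ) (β' : Fin s → Fin n → ℂ) (α' : Fin s → Fin n → Fin n → ℂ), s ≤ n ^ c + c ∧
          q = ∑ t : Fin s, ∏ a : Fin n, (C (β' t a) + ∑ b : Fin n, C (α' t a b) * X (a, b))) ∧
        p = aeval (fun x : Fin n × Fin n => C α * X x + C β * ∑ b : Fin n, X (x.1, b) + C γ * ∑ a : Fin n, X (a, x.2) +
          C δ * ∑ a : Fin n, ∑ b : Fin n, X (a, b) + C ε : Fin n × Fin n → MvPolynomial (Fin n × Fin n) ℂ) q) →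
      2 ^ ((Nat.log 2 n + c) ^ c) < p.support.card → (Nat.log 2 n + c) ^ c < p.totalDegree →
      p ∈ Submodule.span ℂ
        {q : MvPolynomial (Fin n × Fin n) ℂ | ∃ (a b : ℕ) (E : Multiset (Fin a × Fin b)),
          Literature.Combinatorics.SimpleGraph.treewidth
              (SimpleGraph.fromRel fun u v : Fin a ⊕ Fin b =>
                ∃ e ∈ E, u = Sum.inl e.1 ∧ v = Sum.inr e.2) ≤ (Nat.log 2 n + c') ^ c' ∧
            q = homPoly E n ℂ}) :
    ∀ f : (n : ℕ) → MvPolynomial (Fin n × Fin n) ℂ, IsMatrixSymmetric f →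
      (∃ c : ℕ, ∀ n : ℕ, PDClass (fun _ => 1) n c (f n)) →
      ∃ c : ℕ, ∀ n : ℕ, QPOrbitRestorable c n (f n) := by
  refine sigmaPiSigmaValue_of_sharpResidue₉ fun c => ?_
  obtain ⟨c', hc'⟩ := hTW c
  exact ⟨c' + 3, fun n p hsym hPD hng hD hrow hcol hC hR hcat hφC hφR hsp hdeg =>
    qpOrbitRestorable_of_mem_narrowSpan_level c' n p
      (hc' n p hsym hPD hng hD hrow hcol hC hR hcat hφC hφR hsp hdeg)⟩

end Summit.ValiantsHypothesis.ValiantsHypothesis.Theorems.SmlAffineRestoration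

end
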